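/-
Copyright (c) 2026 the pub-hodgecm-mathlib formalisation cell (harness21).  Prover seat hodgecm-mathlib-K2E3-p12 (g8), Track B ∕ K2-LIT, h413 = `stmt-HodgeConjecture-24833`,
line `K2_E1_TraceFormulaBeta`, 5Res ROADCARD «ENDGAME BY FAMILIES» (K2E1-plan (g7), (154)) file C1 «f3-χ» (deal (142)), part GR-χ: TATE'S LEMMA B IN THE IDELE-CLASS-DOMAIN
CURRENCY `𝓕_I` of ★ (δ)₂ ∕ ★ C — the `Y¹`-orthogonality behind the cross-family vanishing (XF) and the off-dual one-term formula (OD) of ROADCARD (154) §1.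
-/
import Literature.NumberTheory.Automorphic.IdeleClassIntegration                          -- ★ `IsIdeleClassDomain`, `.smul`, `.isFundamentalDomain`, `secondCountableTopology_ideleGroup`
import Literature.NumberTheory.Automorphic.IdeleClassGroup                                -- ★ `coe_ideleNorm`, `ideleNorm_principal`
import Literature.NumberTheory.GaloisRepresentations.HeckeCharacterNormOneProofs          -- ★ `exists_ideleNorm_eq_one_and_ne_one_of_not_isNormTwist`, `IsNormTwist.map_eq_one_of_ideleNorm_eq_one`
import HarnessLib

/-!
# C1 «f3-χ», part GR-χ — `K2E1IdeleClassCharacterOrthogonality`: TATE'S LEMMA B ON AN IDELE CLASS DOMAIN `𝓕_I ⊂ 𝕀_K` — translation invariance of `∫_{𝓕_I}`, and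
# `∫_{𝓕_I} G dν = 0` whenever `G(a x) = χ(a)·G(x)` for all norm-one `a` and `χ` is NOT a norm twist (any number field `K`, any left-invariant `ν`)

Track B ∕ K2-LIT, crux h413 = `stmt-HodgeConjecture-24833`, route of record `HCCMUnconditional`; cell `hodgecm-mathlib`, squad K2, ENGINE E1.  THEOREMS ONLY (no `def`, no `instance`,
no `notation`, no named-fact hypothesis, no `sorry`); lane `--supports stmt-HodgeConjecture-24833 --as helper` (count-neutral).  Generic number field `K`.
THE MATHEMATICS ([TateThesis1967, Thm. 4.4.1 (Lemma B)]; [CasselsFrohlichANT1967, Ch. XV §4.4]; [WeilBNT1967, Ch. VII §5]).  The tree holds Lemma B on the compact group `C_K¹ =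
normOne K` (★ `HeckeCharacterOrthogonalityProofs.integral_normOne_eq_zero_of_not_isNormTwist` :132).  The Eisenstein-pairing machinery (★ (δ)₂ `K2E1EisensteinPairingUnfoldedWeightU2`, ★ C
`K2E1IdeleClassRadialIntegralCM`, ★ W-b `K2E1ChiPseudoEisensteinIdeleLevelCMTwo`) lives instead on an IDELE CLASS DOMAIN `𝓕_I ⊂ 𝕀_K` (★ `IsIdeleClassDomain`: a measurable set of
representatives of `𝕀_K∕K^×`).  This file proves Lemma B DIRECTLY in that currency, by Tate's one-line argument: (§1) `∫_{𝓕_I} F(a x) dν(x) = ∫_{a𝓕_I} F dν = ∫_{𝓕_I} F dν` for every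
`K^×`-invariant `F` and every `a ∈ 𝕀_K` (left invariance of `ν`; `a𝓕_I` is again an idele class domain, ★ `IsIdeleClassDomain.smul`; two fundamental domains of the countable group `K^×` carry
the same integral of an invariant function, Mathlib `IsFundamentalDomain.setIntegral_eq` — no integrability hypothesis); (§2) if `G(a x) = χ(a)·G(x)` for all norm-one `a` (so `G` is
`K^×`-invariant: `χ(K^×) = 1`, `‖K^×‖ = 1`) and `χ` is not a norm twist, pick a norm-one `a` with `χ(a) ≠ 1` (★ `exists_ideleNorm_eq_one_and_ne_one_of_not_isNormTwist`): `∫G = ∫G(a·) =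
χ(a)∫G`, hence `∫_{𝓕_I} G dν = 0`.  Typical `G`: `‖x‖⁻¹ • (χ(x)·conj χ′(x)·R(‖x‖))` with `χ′` unitary — the `w = 1` (resp. `w = w₀`, with `χ′ʷ`) term of ★ W-b; so the pairing of two twisted
pseudo-Eisenstein families vanishes unless `χ·χ′⁻¹` (resp. `χ·(χ′ʷ)⁻¹`) is a norm twist (ROADCARD (154) §1 (XF)∕(OD)).  (§3) the complementary case: a norm twist is `1` on norm-one ideles, so
such a `G` is norm-one-translation invariant («radial up to `K^×`»), and a unitary `χ′` has `conj χ′ = χ′⁻¹` pointwise.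
* §1 `setIntegral_ideleClass_comp_mul_eq`.  * §2 **`setIntegral_ideleClass_eq_zero_of_not_isNormTwist`** (Lemma B on `𝓕_I`).  * §3 `IsNormTwist.apply_eq_one_of_ideleNorm_eq_one'`, `IsUnitary.conj_apply`.
HONEST LABEL: HC_CM is proved only modulo the 7 printed citations (2 remaining named inputs: hLiu418 = `stmt-HodgeConjecture-24832`, h413 = `stmt-HodgeConjecture-24833`) until rung 0
closes; this file asserts no named fact, closes no socket; count-neutral; letter-free.

## References
* [TateThesis1967] J. Tate, *Fourier analysis in number fields and Hecke's zeta-functions* (thesis 1950), in Cassels–Fröhlich (1967), Thm. 4.4.1 (Lemma B).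
* [CasselsFrohlichANT1967] J. W. S. Cassels, A. Fröhlich (eds.), *Algebraic Number Theory* (1967), Ch. XV §4.4.
* [WeilBNT1967] A. Weil, *Basic Number Theory* (1967), Ch. VII §5.
-/

set_option autoImplicit false
set_option linter.dupNamespace false  -- the mandated namespace repeats the summit's segment (`HodgeConjecture.HodgeConjecture`)

noncomputable section

open MeasureTheory Measure Set NumberField
open scoped NNReal ENNReal ComplexConjugate Pointwise
open Literature.NumberTheory Literature.NumberTheory.Automorphic
open Literature.NumberTheory.GaloisRepresentations (HeckeCharacter ideleGroup principalIdeles)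

namespace Summit.HodgeConjecture.HodgeConjecture.Cruxes.H413.K2E1IdeleClassCharacterOrthogonality

variable {K : Type} [Field K] [NumberField K]
variable [MeasurableSpace (ideleGroup K)] [BorelSpace (ideleGroup K)]
variable {E : Type} [NormedAddCommGroup E] [NormedSpace ℝ E]

/-! ## §1 Translation invariance of idele-class-domain integrals -/

/-- **`∫_{𝓕_I} F(a·x) dν(x) = ∫_{𝓕_I} F dν`** for an idele class domain `𝓕_I`, a left-invariant `ν` on `𝕀_K`, a `K^×`-invariant `F` and ANY `a ∈ 𝕀_K` (left invariance: `= ∫_{a𝓕_I} F`;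
`a𝓕_I` is an idele class domain ★; two fundamental domains of `K^×` give the same integral of an invariant function, Mathlib — no integrability hypothesis). [cite: TateThesis1967, §4.3]
[cite: WeilBNT1967, Ch. VII §5] -/
theorem setIntegral_ideleClass_comp_mul_eq (ν : Measure (ideleGroup K)) [ν.IsMulLeftInvariant] {𝓕 : Set (ideleGroup K)} (h𝓕 : IsIdeleClassDomain K 𝓕)
    {F : ideleGroup K → E} (hF : ∀ k ∈ principalIdeles K, ∀ x, F (k * x) = F x) (a : ideleGroup K) :
    ∫ x in 𝓕, F (a * x) ∂ν = ∫ x in 𝓕, F x ∂ν := by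
  haveI := secondCountableTopology_ideleGroup K
  haveI : MeasurableMul (ideleGroup K) := by infer_instance
  have h1 : ∫ x in 𝓕, F (a * x) ∂ν = ∫ x, (a • 𝓕).indicator F (a * x) ∂ν := by
    rw [← integral_indicator h𝓕.measurableSet]
    refine integral_congr_ae (ae_of_all _ fun x => ?_)
    have hx : a * x ∈ a • 𝓕 ↔ x ∈ 𝓕 := by rw [← smul_eq_mul, Set.smul_mem_smul_set_iff]
    dsimp only
    by_cases h : x ∈ 𝓕
    · rw [Set.indicator_of_mem h, Set.indicator_of_mem (hx.2 h)]
    · rw [Set.indicator_of_notMem h, Set.indicator_of_notMem (fun h' => h (hx.1 h'))]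
  rw [h1, integral_mul_left_eq_self (fun y => (a • 𝓕).indicator F y) a, integral_indicator (h𝓕.smul a).measurableSet]
  exact ((h𝓕.smul a).isFundamentalDomain ν).setIntegral_eq (h𝓕.isFundamentalDomain ν) fun g x => by
    rw [Subgroup.smul_def, smul_eq_mul]
    exact hF _ g.2 x

/-! ## §2 Lemma B on an idele class domain -/

/-- **TATE'S LEMMA B ON `𝓕_I` (non-trivial case).**  Let `χ` be a Hecke character of `K` which is NOT a norm twist (`¬ χ.IsNormTwist`: non-trivial on the norm-one ideles) and let
`G : 𝕀_K → ℂ` satisfy `G(a x) = χ(a)·G(x)` for every norm-one idele `a` (`‖a‖ = 1` in `IdeleClassGroup.ideleNorm` currency).  Then for every idele class domain `𝓕_I` and every left-invariant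
`ν`: **`∫_{𝓕_I} G dν = 0`** (`G` is `K^×`-invariant since `χ(K^×) = 1`, `‖K^×‖ = 1`; §1 with a norm-one `a`, `χ(a) ≠ 1` ★, gives `∫G = χ(a)∫G`).  [cite: TateThesis1967, Thm. 4.4.1 (Lemma B)]
[cite: CasselsFrohlichANT1967, Ch. XV §4.4] -/
theorem setIntegral_ideleClass_eq_zero_of_not_isNormTwist (ν : Measure (ideleGroup K)) [ν.IsMulLeftInvariant] {𝓕 : Set (ideleGroup K)} (h𝓕 : IsIdeleClassDomain K 𝓕)
    {χ : HeckeCharacter K} (hχ : ¬ χ.IsNormTwist) {G : ideleGroup K → ℂ}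
    (hG : ∀ a : ideleGroup K, IdeleClassGroup.ideleNorm K a = 1 → ∀ x, G (a * x) = ((χ a : ℂˣ) : ℂ) * G x) :
    ∫ x in 𝓕, G x ∂ν = 0 := by
  obtain ⟨a, ha1, hne⟩ := HeckeCharacter.exists_ideleNorm_eq_one_and_ne_one_of_not_isNormTwist hχ
  have ha1' : IdeleClassGroup.ideleNorm K a = 1 := NNReal.coe_injective (by rw [coe_ideleNorm, ha1, NNReal.coe_one])
  have hF : ∀ k ∈ principalIdeles K, ∀ x, G (k * x) = G x := fun k hk x => by
    rw [hG k (ideleNorm_principal hk) x, HeckeCharacter.map_principal χ hk, Units.val_one, one_mul]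
  have h := setIntegral_ideleClass_comp_mul_eq ν h𝓕 hF a
  simp only [hG a ha1'] at h
  rw [integral_const_mul] at h
  have hne' : ((χ a : ℂˣ) : ℂ) - 1 ≠ 0 := sub_ne_zero.2 fun h1 => hne (Units.val_eq_one.1 h1)
  have h2 : (((χ a : ℂˣ) : ℂ) - 1) * ∫ x in 𝓕, G x ∂ν = 0 := by rw [sub_one_mul, h, sub_self]
  exact (mul_eq_zero.1 h2).resolve_left hne'

/-- **Lemma B on `𝓕_I`, weighted-product form**: `∫_{𝓕_I} c(x) • (χ(x)·R(x)) dν = 0` for `χ` not a norm twist, any real weight `c` and any `R : 𝕀_K → ℂ` invariant under norm-one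
translations (`c(a x) = c(x)`, `R(a x) = R(x)` for `‖a‖ = 1` — e.g. `c = ‖·‖⁻¹`, `R` a function of `‖x‖`; the shape of the `w = 1` ∕ `w = w₀` terms of ★ W-b). [cite: TateThesis1967, Thm. 4.4.1 (Lemma B)] -/
theorem setIntegral_ideleClass_smul_mul_eq_zero_of_not_isNormTwist (ν : Measure (ideleGroup K)) [ν.IsMulLeftInvariant] {𝓕 : Set (ideleGroup K)} (h𝓕 : IsIdeleClassDomain K 𝓕)
    {χ : HeckeCharacter K} (hχ : ¬ χ.IsNormTwist) {c : ideleGroup K → ℝ} {R : ideleGroup K → ℂ}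
    (hc : ∀ a : ideleGroup K, IdeleClassGroup.ideleNorm K a = 1 → ∀ x, c (a * x) = c x) (hR : ∀ a : ideleGroup K, IdeleClassGroup.ideleNorm K a = 1 → ∀ x, R (a * x) = R x) :
    ∫ x in 𝓕, c x • (((χ x : ℂˣ) : ℂ) * R x) ∂ν = 0 :=
  setIntegral_ideleClass_eq_zero_of_not_isNormTwist ν h𝓕 hχ fun a ha x => by
    rw [hc a ha x, hR a ha x, map_mul, Units.val_mul, Complex.real_smul, Complex.real_smul]
    ring

/-! ## §3 The complementary bookkeeping: norm twists are norm-one invariant; unitary characters have `conj χ = χ⁻¹` -/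

omit [MeasurableSpace (ideleGroup K)] [BorelSpace (ideleGroup K)] in
/-- A norm twist is `1` on norm-one ideles (`IdeleClassGroup.ideleNorm` currency; ★ `IsNormTwist.map_eq_one_of_ideleNorm_eq_one`). [cite: TateThesis1967, §4.3] -/
theorem apply_eq_one_of_isNormTwist_of_ideleNorm_eq_one {χ : HeckeCharacter K} (hχ : χ.IsNormTwist) {a : ideleGroup K} (ha : IdeleClassGroup.ideleNorm K a = 1) : χ a = 1 :=
  hχ.map_eq_one_of_ideleNorm_eq_one (by rw [← coe_ideleNorm, ha, NNReal.coe_one])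

omit [MeasurableSpace (ideleGroup K)] [BorelSpace (ideleGroup K)] in
/-- For a norm twist `χ` and `G(a x) = χ(a)·G(x)` on norm-one `a`, `G` is norm-one-translation invariant. [cite: TateThesis1967, §4.3] -/
theorem apply_mul_eq_of_isNormTwist {χ : HeckeCharacter K} (hχ : χ.IsNormTwist) {G : ideleGroup K → ℂ}
    (hG : ∀ a : ideleGroup K, IdeleClassGroup.ideleNorm K a = 1 → ∀ x, G (a * x) = ((χ a : ℂˣ) : ℂ) * G x) {a : ideleGroup K} (ha : IdeleClassGroup.ideleNorm K a = 1)
    (x : ideleGroup K) : G (a * x) = G x := by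
  rw [hG a ha x, apply_eq_one_of_isNormTwist_of_ideleNorm_eq_one hχ ha, Units.val_one, one_mul]

omit [MeasurableSpace (ideleGroup K)] [BorelSpace (ideleGroup K)] in
/-- For a unitary Hecke character, `conj (χ x) = (χ⁻¹) x = (χ x)⁻¹`. [folklore] -/
theorem conj_apply_of_isUnitary {χ : HeckeCharacter K} (hχ : χ.IsUnitary) (x : ideleGroup K) : conj ((χ x : ℂˣ) : ℂ) = ((χ x : ℂˣ) : ℂ)⁻¹ :=
  (Complex.inv_eq_conj (hχ x)).symm

omit [MeasurableSpace (ideleGroup K)] [BorelSpace (ideleGroup K)] in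
/-- `χ(a)·conj χ′(a) = (χ·χ′⁻¹)(a)` for unitary `χ′` — the character of the `w = 1` term (`χ′ʷ` in place of `χ′` for the `w = w₀` term). [folklore] -/
theorem apply_mul_conj_apply_of_isUnitary (χ : HeckeCharacter K) {χ' : HeckeCharacter K} (hχ' : χ'.IsUnitary) (a : ideleGroup K) :
    ((χ a : ℂˣ) : ℂ) * conj ((χ' a : ℂˣ) : ℂ) = (((χ * χ'⁻¹) a : ℂˣ) : ℂ) := by
  rw [conj_apply_of_isUnitary hχ' a]
  simp

end Summit.HodgeConjecture.HodgeConjecture.Cruxes.H413.K2E1IdeleClassCharacterOrthogonality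

end
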